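import Summits.BirchSwinnertonDyer.Rank1Residual.Additive.LocalTowerKernelPrimaryExact
import Literature.NumberTheory.EllipticCurves.IwasawaSelmerControlKernelCardProofs
import HarnessLib

set_option linter.dupNamespace false -- `…BirchSwinnertonDyer.BirchSwinnertonDyer…` is the cell's nested layout (D-0017)
set_option autoImplicit false

/-!
# Greenberg LNM 1716 Lemma 3.4 at `n = 0`, step 1a: inflation cocycles with ARBITRARY (not only torsion) prescribed
# values along a `ℤ_p`-extension, and the generic count `#ker(res)[p^∞] = #(M^N/(γ − 1)M^N)[p^∞]`

Seat `bsd-inputs-k4-p1` (gen 5; LADDER-BSD D-0154 KEY (147)(f) «prove the printed input», row 1 K4 INPUTS; Greenberg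
1999), `--supports stmt-BirchSwinnertonDyer-20309`. THEOREMS ONLY (no definition, no named fact, no `sorry`).

R. Greenberg, *Iwasawa theory for elliptic curves*, LNM 1716 (1999), §3 (pp. 86–89): the local tower kernel
`ker(r_v) ≅ H¹(Γ_v, E(K_{∞,η}))`, `Γ_v = Gal(K_{∞,η}/K_v) ≅ ℤ_p` topologically generated by `g`, and for a pro-cyclic
`Γ_v` one has `H¹(Γ_v, M) ≅ (M/(g − 1)M)[p^∞]` on `p`-primary parts. The tree (cell b2b-bsdres, file 52,
`Rank1Residual.Additive.natCard_localTowerKerPrimary_zero_eq`) proves `#𝒦_{E,0}[p^∞] = #(M/(g−1)M)[p^∞]`,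
`M = E(K̄_E)^{H_{E,∞}}`, under the hypothesis (hdiv) «`M` is `p`-divisible modulo `M[p^∞]`» — true at `v ∤ p`
(Prop. 2.1) but FALSE at `v ∣ p`, where `E(K_{∞,η}) ⊗ ℚ_p/ℤ_p ≠ 0`. This file removes (hdiv): the surjectivity of the
evaluation map onto the `p`-primary classes needs inflation cocycles with an ARBITRARY prescribed value `b ∈ M` at `g`,
which exist exactly when the norm sums `s_j = b + g b + ⋯ + g^{j−1} b` are eventually `p`-power periodic, i.e.
`s_{pⁿ} = 0` for some `n`; and for a class `[b]` killed by `p^k` in `M/(g−1)M` — `p^k b = g y − y` — one has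
`s_{p^{n+k}} = p^k s_{pⁿ} = g^{pⁿ} y − y = 0` as soon as `g^{pⁿ}` fixes `b` and `y`.

* §1 `natCard_primary_subgroupResKer_eq_of_cocycles` — generic (`G`, normal `N`, discrete `M`, `γ` generating `G`
  with `N` topologically): `#{x ∈ ker(res : H¹(G,M) → H¹(N,M)) : p-power torsion} = #(M^N/(γ−1)M^N)[p^∞]` as soon as
  every `b ∈ M^N` whose class is `p`-power torsion is `ψ(γ)` for a continuous cocycle `ψ` on `G` vanishing on `N`.
* §2 `ZpExtension.exists_pow_pow_mem_of_isOpen`, `…sSeq_…` bookkeeping and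
  **`ZpExtension.exists_cocycle_vanishing_apply_eq_of_sSeq_eq_zero`** — for a `ℤ_p`-extension `κ` of a field with
  topological generator `γ₀`, a discrete `Γ`-module `M` with continuous orbit maps, and `b ∈ M^{ker κ}` with
  `s_{pⁿ}(b) = 0`: a continuous cocycle `ψ` on `Γ` vanishing on `ker κ` with `ψ(γ₀) = b` (`ψ(g) = s_{a}` for
  `κ g ≡ a mod pⁿ`); and `…_of_nsmul_eq_sub` — the same for every `b` with `p^k b = γ₀ y − y`, `y ∈ M^{ker κ}`.
(The local counts — `#𝒦_{E,0}[p^∞] = #(E(K̄_E)^{ker κE}/(g − 1))[p^∞]` and its analogue for any discrete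
`Γ_E`-module — are in the sequel `PublishedInputsGreenbergLemma34KernelCoinvariants`.)

HONEST FRAMING: TOOL theorems (group cohomology bookkeeping); closes nothing; no summit statement is proved; BSD is not
proved by any of this.

References: [GreenbergLNM1716] §3 Lemmas 3.1–3.4 (pp. 86–89); [SerreGaloisCohomology1997] I.§2.6, XIII.§1.
-/

noncomputable section

open scoped Classical

universe u

namespace Summit.BirchSwinnertonDyer.BirchSwinnertonDyer.Theorems.InputsGreenbergLemma34

open Literature.NumberTheory.EllipticCurves Literature.NumberTheory.GaloisRepresentations
  Literature.NumberTheory.EllipticCurves.ResKernel Literature.NumberTheory.EllipticCurves.PrimaryCoinvariants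
  Literature.NumberTheory.EllipticCurves.LayerCocycle ZpExtension

/-! ## §1 Generic: the `p`-primary evaluation embedding is onto, given cocycles for torsion classes -/

section Generic

variable {G : Type u} [Group G] [TopologicalSpace G] [IsTopologicalGroup G]
  (N : Subgroup G) [N.Normal] (M : Type u) [AddCommGroup M] [DistribMulAction G M]
  [TopologicalSpace M] [DiscreteTopology M]

/-- **`#{x ∈ ker(res : H¹(G,M) → H¹(N,M)) : p-power torsion} = #(M^N/(γ−1)M^N)[p^∞]`** when `N` and `γ` generate `G`
topologically and (hinf) every `b ∈ M^N` whose class in `M^N/(γ−1)M^N` is `p`-power torsion is `ψ(γ)` for a continuous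
cocycle `ψ` on `G` vanishing on `N`: the tree's injective evaluation map (`exists_addMonoidHom_subgroupResKer_injective`)
is then onto the `p`-primary classes. No divisibility hypothesis (compare file 52's `natCard_primary_subgroupResKer_eq`).
[cite: GreenbergLNM1716, §3 Lemmas 3.1 and 3.3 (pp. 86–87)] [cite: SerreGaloisCohomology1997, XIII.§1] -/
theorem natCard_primary_subgroupResKer_eq_of_cocycles (γ : G)
    (hgen : ∀ U : Subgroup G, IsOpen (U : Set G) → N ≤ U → γ ∈ U → U = ⊤)
    (hcont : ∀ m : M, Continuous fun g : G ↦ g • m) (p : ℕ)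
    (hinf : ∀ b : FixedPoints.addSubgroup N M,
      (∃ k : ℕ, p ^ k • (QuotientAddGroup.mk b : FixedPoints.addSubgroup N M ⧸ (subOne N M γ).range) = 0) →
      ∃ ψ : contOneCocycles (discreteTopRep G M), (∀ n ∈ N, ψ.1 n = 0) ∧ ψ.1 γ = b) :
    Nat.card {x : subgroupResKer M N // ∃ k : ℕ, p ^ k • x = 0} =
      Nat.card (AddCommGroup.primaryComponent
        (FixedPoints.addSubgroup N M ⧸ (subOne N M γ).range) p) := by
  obtain ⟨w, hw, hwval⟩ := exists_addMonoidHom_subgroupResKer_injective N M γ hgen hcont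
  let f : {x : subgroupResKer M N // ∃ k : ℕ, p ^ k • x = 0} →
      AddCommGroup.primaryComponent (FixedPoints.addSubgroup N M ⧸ (subOne N M γ).range) p :=
    fun x ↦ ⟨w x.1, by
      obtain ⟨k, hk⟩ := x.2
      exact (AddCommGroup.mem_primaryComponent).mpr ⟨k, by rw [← map_nsmul, hk, map_zero]⟩⟩
  have hf : Function.Injective f := fun x y hxy ↦ Subtype.ext (hw (Subtype.ext_iff.mp hxy))
  have hfsurj : Function.Surjective f := by
    rintro ⟨q, hq⟩
    obtain ⟨k, hk⟩ := (AddCommGroup.mem_primaryComponent).mp hq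
    obtain ⟨b, rfl⟩ := QuotientAddGroup.mk_surjective q
    obtain ⟨ψ, hψN, hψγ⟩ := hinf b ⟨k, hk⟩
    -- the class of `ψ` lies in `ker res`, evaluates to `[b]`, and is `p`-power torsion
    have hmem : oneCocycleClass _ ψ ∈ subgroupResKer M N := by
      rw [mem_subgroupResKer_iff, ResKernel.resSubgroup_oneCocycleClass]
      have h0 : contOneCocycles.pullback (Literature.NumberTheory.EllipticCurves.subgroupIncl N)
          (resHomOfEquivariant (Literature.NumberTheory.EllipticCurves.subgroupIncl N) (AddMonoidHom.id M)
            (fun _ _ ↦ rfl)) ψ = 0 := by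
        apply Subtype.ext
        ext n
        rw [pullback_subtype_apply]
        exact hψN n n.2
      rw [h0, oneCocycleClass_zero]
    have hwx : w ⟨_, hmem⟩ = QuotientAddGroup.mk b := by
      rw [hwval ⟨_, hmem⟩ ψ hψN rfl]
      exact congrArg _ (Subtype.ext hψγ)
    have htors : ∃ k : ℕ, p ^ k • (⟨_, hmem⟩ : subgroupResKer M N) = 0 :=
      ⟨k, hw (by rw [map_nsmul, map_zero, hwx, hk])⟩
    exact ⟨⟨⟨_, hmem⟩, htors⟩, Subtype.ext hwx⟩
  exact Nat.card_congr (Equiv.ofBijective f ⟨hf, hfsurj⟩)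

end Generic

/-! ## §2 Inflation cocycles with an arbitrary prescribed value, from the norm condition `s_{pⁿ} = 0` -/

section Cocycle

variable {K : Type u} [Field K] [CharZero K] {p : ℕ} [hp : Fact p.Prime] (κ : ZpExtension K p)
  {M : Type u} [AddCommGroup M] [DistribMulAction (Field.absoluteGaloisGroup K) M]
  [TopologicalSpace M] [DiscreteTopology M]

/-- **An open subgroup containing `ker κ` contains some `γ₀^{p^A}`**: `κ(U) ⊇ p^A ℤ_p`
(`exists_forall_exists_toAdd_eq`), so some `u ∈ U` has `κ u = κ(γ₀^{p^A})` and `u⁻¹ γ₀^{p^A} ∈ ker κ ≤ U`.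
[cite: Washington1997, §13.1] -/
theorem _root_.Literature.NumberTheory.EllipticCurves.ZpExtension.exists_pow_pow_mem_of_isOpen
    {γ₀ : Field.absoluteGaloisGroup K} (hγ₀ : κ.IsTopGenerator γ₀)
    (U : Subgroup (Field.absoluteGaloisGroup K)) (hU : IsOpen (U : Set (Field.absoluteGaloisGroup K)))
    (hN : κ.kerSubgroup ≤ U) : ∃ A : ℕ, γ₀ ^ p ^ A ∈ U := by
  obtain ⟨A, hA⟩ := κ.exists_forall_exists_toAdd_eq U hU
  obtain ⟨u, huU, hu⟩ := hA 1
  refine ⟨A, ?_⟩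
  have hmem : u⁻¹ * γ₀ ^ p ^ A ∈ κ.kerSubgroup := by
    rw [ZpExtension.mem_kerSubgroup]
    apply Multiplicative.toAdd.injective
    have h1 := κ.toAdd_map_pow_pow hγ₀ A 1
    rw [pow_one] at h1
    rw [map_mul, map_inv, toAdd_mul, toAdd_inv, h1, hu, toAdd_one, mul_one, Nat.cast_one, one_mul,
      neg_add_cancel]
  have h := U.mul_mem huU (hN hmem)
  rwa [mul_inv_cancel_left] at h

omit [CharZero K] hp [TopologicalSpace M] [DiscreteTopology M] in
/-- Periodicity of the norm sums: `s_{pⁿ} = 0` gives `s_{j + q pⁿ} = s_j`. [folklore] -/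
theorem sSeq_add_mul_eq_of_sSeq_eq_zero (γ₀ : Field.absoluteGaloisGroup K) (b : M) {n : ℕ}
    (hnorm : sSeq γ₀ b (p ^ n) = 0) (j q : ℕ) : sSeq γ₀ b (j + q * p ^ n) = sSeq γ₀ b j := by
  induction q with
  | zero => rw [zero_mul, add_zero]
  | succ q ih =>
    rw [Nat.succ_mul, ← add_assoc, sSeq_add γ₀ b (j + q * p ^ n) (p ^ n), hnorm, smul_zero, add_zero, ih]

omit [CharZero K] hp [TopologicalSpace M] [DiscreteTopology M] in
/-- `s_a = s_{a'}` for `a ≡ a' (mod pⁿ)` when `s_{pⁿ} = 0`. [folklore] -/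
theorem sSeq_eq_of_modEq (γ₀ : Field.absoluteGaloisGroup K) (b : M) {n : ℕ}
    (hnorm : sSeq γ₀ b (p ^ n) = 0) {a a' : ℕ} (h : a ≡ a' [MOD p ^ n]) :
    sSeq γ₀ b a = sSeq γ₀ b a' := by
  have ha : sSeq γ₀ b a = sSeq γ₀ b (a % p ^ n) := by
    conv_lhs => rw [← Nat.mod_add_div a (p ^ n), mul_comm]
    exact sSeq_add_mul_eq_of_sSeq_eq_zero γ₀ b hnorm _ _
  have ha' : sSeq γ₀ b a' = sSeq γ₀ b (a' % p ^ n) := by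
    conv_lhs => rw [← Nat.mod_add_div a' (p ^ n), mul_comm]
    exact sSeq_add_mul_eq_of_sSeq_eq_zero γ₀ b hnorm _ _
  rw [ha, ha', h]

omit [CharZero K] [TopologicalSpace M] [DiscreteTopology M] in
/-- **The congruence class of `κ g` mod `pⁿ` determines `s`.** If `p^n ∣ κ g − a` and `p^n ∣ κ g − a'` in `ℤ_p`
(`a, a' ∈ ℕ`), then `s_a = s_{a'}`. [folklore] -/
theorem sSeq_eq_of_dvd_sub (γ₀ : Field.absoluteGaloisGroup K) (b : M) {n : ℕ}
    (hnorm : sSeq γ₀ b (p ^ n) = 0) (g : Field.absoluteGaloisGroup K) {a a' : ℕ}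
    (ha : (p : ℤ_[p]) ^ n ∣ (κ g).toAdd - (a : ℤ_[p])) (ha' : (p : ℤ_[p]) ^ n ∣ (κ g).toAdd - (a' : ℤ_[p])) :
    sSeq γ₀ b a = sSeq γ₀ b a' := by
  refine sSeq_eq_of_modEq γ₀ b hnorm (Nat.modEq_iff_dvd.mpr ?_)
  have h : (p : ℤ_[p]) ^ n ∣ (((a' : ℤ) - (a : ℤ) : ℤ) : ℤ_[p]) := by
    have h1 := dvd_sub ha ha'
    rw [sub_sub_sub_cancel_left] at h1
    push_cast
    exact h1
  rw [PadicInt.pow_p_dvd_int_iff] at h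
  exact_mod_cast h

omit [CharZero K] [TopologicalSpace M] [DiscreteTopology M] in
/-- `s_1 = b`. [folklore] -/
theorem sSeq_one (γ₀ : Field.absoluteGaloisGroup K) (b : M) : sSeq γ₀ b 1 = b := by
  rw [show (1 : ℕ) = 0 + 1 from rfl, sSeq_succ, sSeq_zero, pow_zero, one_smul, zero_add]

omit [CharZero K] [TopologicalSpace M] [DiscreteTopology M] in
/-- Telescoping: the norm sums of `γ₀ y − y` are `s_j = γ₀^j y − y`. [folklore] -/
theorem sSeq_smul_sub (γ₀ : Field.absoluteGaloisGroup K) (y : M) (j : ℕ) :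
    sSeq γ₀ (γ₀ • y - y) j = γ₀ ^ j • y - y := by
  induction j with
  | zero => rw [sSeq_zero, pow_zero, one_smul, sub_self]
  | succ j ih => rw [sSeq_succ, ih, smul_sub, ← mul_smul, ← pow_succ]; abel

omit [CharZero K] [TopologicalSpace M] [DiscreteTopology M] in
/-- Linearity of the norm sums in the value: `s_j(c • b) = c • s_j(b)`. [folklore] -/
theorem sSeq_nsmul (γ₀ : Field.absoluteGaloisGroup K) (b : M) (c j : ℕ) :
    sSeq γ₀ (c • b) j = c • sSeq γ₀ b j := by
  induction j with
  | zero => rw [sSeq_zero, sSeq_zero, smul_zero]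
  | succ j ih =>
    rw [sSeq_succ, sSeq_succ, ih, smul_add c]
    congr 1
    exact map_nsmul (DistribSMul.toAddMonoidHom M (γ₀ ^ j)) c b

omit [CharZero K] [TopologicalSpace M] [DiscreteTopology M] in
/-- A power of `γ₀` fixing `b` fixes every norm sum `s_j(b)`. [folklore] -/
theorem pow_smul_sSeq (γ₀ : Field.absoluteGaloisGroup K) (b : M) {c : ℕ} (hc : γ₀ ^ c • b = b) (j : ℕ) :
    γ₀ ^ c • sSeq γ₀ b j = sSeq γ₀ b j := by
  induction j with
  | zero => rw [sSeq_zero, smul_zero]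
  | succ j ih =>
    rw [sSeq_succ, smul_add, ih]
    congr 1
    rw [← mul_smul, ← pow_add, add_comm c j, pow_add, mul_smul, hc]

omit [CharZero K] [TopologicalSpace M] [DiscreteTopology M] in
/-- Multiples of a period: if `γ₀^{m}` fixes `b` then `s_{q m} = q • s_m`. [folklore] -/
theorem sSeq_mul_eq_nsmul (γ₀ : Field.absoluteGaloisGroup K) (b : M) {m : ℕ} (hm : γ₀ ^ m • b = b) (q : ℕ) :
    sSeq γ₀ b (q * m) = q • sSeq γ₀ b m := by
  have hfix : ∀ q : ℕ, γ₀ ^ (q * m) • b = b := by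
    intro q
    induction q with
    | zero => rw [zero_mul, pow_zero, one_smul]
    | succ q ih => rw [Nat.succ_mul, pow_add, mul_smul, hm, ih]
  induction q with
  | zero => rw [zero_mul, sSeq_zero, zero_smul]
  | succ q ih => rw [Nat.succ_mul, sSeq_add, ih, pow_smul_sSeq γ₀ b (hfix q) m, succ_nsmul]

/-- **Inflation cocycles with an arbitrary prescribed value.** Let `κ` be a `ℤ_p`-extension of `K` with topological
generator `γ₀`, `M` a discrete `Γ_K`-module with continuous orbit maps, and `b ∈ M` fixed by `ker κ` with
`s_{pⁿ}(b) = b + γ₀ b + ⋯ + γ₀^{pⁿ−1} b = 0`. Then there is a continuous cocycle `ψ` on `Γ_K` vanishing on `ker κ`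
with `ψ(γ₀) = b`: `ψ(g) = s_a` for any `a ∈ ℕ` with `κ g ≡ a (mod pⁿ)` — the inflation of the crossed homomorphism of
`Γ = Γ_K / ker κ ≅ ℤ_p` determined by `γ₀ ↦ b`, continuous because `a ↦ s_a` is `pⁿ`-periodic. (The tree's
`ZpExtension.exists_cocycle_vanishing_apply_eq` is the case of a `p`-primary module, where the periodicity is automatic.)
[cite: SerreGaloisCohomology1997, I.§2.6, XIII.§1] [cite: GreenbergLNM1716, §3 Lemma 3.1 (p. 86)] -/
theorem _root_.Literature.NumberTheory.EllipticCurves.ZpExtension.exists_cocycle_vanishing_apply_eq_of_sSeq_eq_zero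
    {γ₀ : Field.absoluteGaloisGroup K} (hγ₀ : κ.IsTopGenerator γ₀)
    (hcont : ∀ m : M, Continuous fun g : Field.absoluteGaloisGroup K ↦ g • m) (b : M)
    (hb : ∀ τ ∈ κ.kerSubgroup, τ • b = b) {n : ℕ} (hnorm : sSeq γ₀ b (p ^ n) = 0) :
    ∃ ψ : contOneCocycles (discreteTopRep (Field.absoluteGaloisGroup K) M),
      (∀ τ ∈ κ.kerSubgroup, ψ.1 τ = 0) ∧ ψ.1 γ₀ = b := by
  -- notation
  let G := Field.absoluteGaloisGroup K
  let V : Subgroup G := κ.layerSubgroup n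
  have hVo : IsOpen (V : Set G) := κ.isOpen_layerSubgroup n
  -- `γ₀^{pⁿ}` fixes `b`
  have hγb : γ₀ ^ p ^ n • b = b := by
    have h := sSeq_add γ₀ b (p ^ n) 1
    rw [hnorm, zero_add, sSeq_one, show p ^ n + 1 = 1 + 1 * p ^ n by ring,
      sSeq_add_mul_eq_of_sSeq_eq_zero γ₀ b hnorm, sSeq_one] at h
    exact h.symm
  -- the stabiliser of `b` is open and contains `ker κ` and `γ₀^{pⁿ}`, hence `V`
  let U : Subgroup G := MulAction.stabilizer G b
  have hUo : IsOpen (U : Set G) := by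
    have e : (U : Set G) = (fun g : G ↦ g • b) ⁻¹' {b} := by
      ext g
      exact MulAction.mem_stabilizer_iff
    rw [e]
    exact (isOpen_discrete _).preimage (hcont b)
  have hNU : κ.kerSubgroup ≤ U := fun τ hτ ↦ MulAction.mem_stabilizer_iff.mpr (hb τ hτ)
  have hVU : V ≤ U := κ.layerSubgroup_le_of_isOpen hγ₀ n U hUo hNU (MulAction.mem_stabilizer_iff.mpr hγb)
  have hVb : ∀ v ∈ V, v • b = b := fun v hv ↦ MulAction.mem_stabilizer_iff.mp (hVU hv)
  have hVs : ∀ v ∈ V, ∀ j, v • sSeq γ₀ b j = sSeq γ₀ b j := fun v hv j ↦ smul_sSeq γ₀ b V hVb hv j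
  have hNs : ∀ τ ∈ κ.kerSubgroup, ∀ j, τ • sSeq γ₀ b j = sSeq γ₀ b j := fun τ hτ j ↦
    smul_sSeq γ₀ b κ.kerSubgroup hb hτ j
  -- the decomposition `g = γ₀^a τ v`
  have hmem0 : ∀ g : G, g ∈ κ.layerSubgroup 0 := fun g ↦ by
    rw [layerSubgroup_zero]; exact Subgroup.mem_top g
  choose kx τx vx hτx hvx hx using fun g : G ↦ κ.exists_eq_pow_mul_mul hγ₀ 0 V hVo (hmem0 g)
  -- `κ g ≡ kx g (mod pⁿ)`
  have hcong : ∀ g : G, (p : ℤ_[p]) ^ n ∣ (κ g).toAdd - (kx g : ℤ_[p]) := by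
    intro g
    have h1 : (κ ((γ₀ ^ p ^ 0) ^ kx g * τx g)).toAdd = (kx g : ℤ_[p]) * (p : ℤ_[p]) ^ 0 :=
      κ.toAdd_map_pow_mul hγ₀ 0 (kx g) (hτx g)
    have h2 : (p : ℤ_[p]) ^ n ∣ (κ (vx g)).toAdd := ZpExtension.mem_layerSubgroup.mp (hvx g)
    have e : κ g = κ ((γ₀ ^ p ^ 0) ^ kx g * τx g * vx g) := congrArg κ (hx g)
    rw [e, map_mul, toAdd_mul, h1, pow_zero, mul_one, add_sub_cancel_left]
    exact h2
  -- the function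
  let ψf : G → M := fun g ↦ sSeq γ₀ b (kx g)
  have hψf : ∀ (g : G) (a : ℕ), (p : ℤ_[p]) ^ n ∣ (κ g).toAdd - (a : ℤ_[p]) → ψf g = sSeq γ₀ b a :=
    fun g a ha ↦ sSeq_eq_of_dvd_sub κ γ₀ b hnorm g (hcong g) ha
  -- continuity: `ψ` is constant on the cosets of the open subgroup `V`
  have hcontψ : Continuous ψf := by
    refine IsLocallyConstant.continuous ((IsLocallyConstant.iff_exists_open ψf).mpr fun x ↦ ?_)
    refine ⟨{y | x⁻¹ * y ∈ V}, ?_, ?_, fun y hy ↦ ?_⟩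
    · exact hVo.preimage (continuous_const.mul continuous_id)
    · show x⁻¹ * x ∈ V
      rw [inv_mul_cancel]
      exact one_mem _
    · refine hψf y (kx x) ?_
      have hy' : (p : ℤ_[p]) ^ n ∣ (κ (x⁻¹ * y)).toAdd := ZpExtension.mem_layerSubgroup.mp hy
      have e : (κ y).toAdd = (κ x).toAdd + (κ (x⁻¹ * y)).toAdd := by
        rw [← toAdd_mul, ← map_mul, mul_inv_cancel_left]
      rw [e, add_sub_right_comm]
      exact dvd_add (hcong x) hy'
  -- the cocycle identity
  have hmul : ∀ g h : G, ψf (g * h) = ψf g + g • ψf h := by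
    intro g h
    have e1 : ψf (g * h) = sSeq γ₀ b (kx g + kx h) := by
      refine hψf (g * h) (kx g + kx h) ?_
      have h' := dvd_add (hcong g) (hcong h)
      rw [map_mul, toAdd_mul, Nat.cast_add]
      convert h' using 1
      ring
    have e2 : g • sSeq γ₀ b (kx h) = ((γ₀ ^ p ^ 0) ^ kx g * τx g * vx g) • sSeq γ₀ b (kx h) := by
      rw [← hx g]
    rw [e1, sSeq_add]
    change _ = sSeq γ₀ b (kx g) + g • sSeq γ₀ b (kx h)
    rw [e2, mul_smul, mul_smul, hVs _ (hvx g), hNs _ (hτx g), pow_zero, pow_one]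
  refine ⟨⟨⟨ψf, hcontψ⟩, fun g h ↦ hmul g h⟩, fun τ hτ ↦ ?_, ?_⟩
  · show ψf τ = 0
    rw [hψf τ 0 (by
      rw [ZpExtension.mem_kerSubgroup.mp hτ, toAdd_one, Nat.cast_zero, sub_zero]; exact dvd_zero _), sSeq_zero]
  · show ψf γ₀ = b
    have hγ' : κ γ₀ = Multiplicative.ofAdd 1 := hγ₀
    rw [hψf γ₀ 1 (by rw [hγ', toAdd_ofAdd, Nat.cast_one, sub_self]; exact dvd_zero _), sSeq_one]

/-- **Inflation cocycles for `p`-power-torsion classes of `M^{ker κ}/(γ₀ − 1)`.** With `κ`, `γ₀`, `M` as in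
`exists_cocycle_vanishing_apply_eq_of_sSeq_eq_zero`: if `b, y ∈ M` are fixed by `ker κ` and `p^k b = γ₀ y − y`, there is
a continuous cocycle on `Γ_K` vanishing on `ker κ` with value `b` at `γ₀`. (Some `γ₀^{pⁿ}` fixes `b` and `y` — the
stabilisers are open and contain `ker κ` — and then `s_{p^{n+k}}(b) = p^k s_{pⁿ}(b) = s_{pⁿ}(γ₀ y − y) = γ₀^{pⁿ} y − y = 0`.)
This is the surjectivity half of `H¹(Γ, M) ≅ (M/(γ₀−1)M)[p^∞]` for the pro-cyclic `Γ = Γ_K/ker κ` (Greenberg, LNM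
1716, §3: "`ker(r_v) ≅ H¹(Γ_v, ·)`"). [cite: GreenbergLNM1716, §3 Lemmas 3.1, 3.3, 3.4 (pp. 86–89)]
[cite: SerreGaloisCohomology1997, XIII.§1] -/
theorem _root_.Literature.NumberTheory.EllipticCurves.ZpExtension.exists_cocycle_vanishing_apply_eq_of_nsmul_eq_sub
    {γ₀ : Field.absoluteGaloisGroup K} (hγ₀ : κ.IsTopGenerator γ₀)
    (hcont : ∀ m : M, Continuous fun g : Field.absoluteGaloisGroup K ↦ g • m) (b : M)
    (hb : ∀ τ ∈ κ.kerSubgroup, τ • b = b) {k : ℕ} {y : M} (hy : ∀ τ ∈ κ.kerSubgroup, τ • y = y)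
    (hbk : p ^ k • b = γ₀ • y - y) :
    ∃ ψ : contOneCocycles (discreteTopRep (Field.absoluteGaloisGroup K) M),
      (∀ τ ∈ κ.kerSubgroup, ψ.1 τ = 0) ∧ ψ.1 γ₀ = b := by
  let G := Field.absoluteGaloisGroup K
  -- an open subgroup fixing `b` and `y`, containing `ker κ`, hence some `γ₀^{pⁿ}`
  let U : Subgroup G := MulAction.stabilizer G b ⊓ MulAction.stabilizer G y
  have hUo : IsOpen (U : Set G) := by
    have e : (U : Set G) = (fun g : G ↦ g • b) ⁻¹' {b} ∩ (fun g : G ↦ g • y) ⁻¹' {y} := by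
      ext g
      rw [Subgroup.coe_inf, Set.mem_inter_iff, Set.mem_inter_iff]
      exact Iff.rfl
    rw [e]
    exact ((isOpen_discrete _).preimage (hcont b)).inter ((isOpen_discrete _).preimage (hcont y))
  have hNU : κ.kerSubgroup ≤ U := fun τ hτ ↦
    ⟨MulAction.mem_stabilizer_iff.mpr (hb τ hτ), MulAction.mem_stabilizer_iff.mpr (hy τ hτ)⟩
  obtain ⟨n, hn⟩ := κ.exists_pow_pow_mem_of_isOpen hγ₀ U hUo hNU
  have hnb : γ₀ ^ p ^ n • b = b := MulAction.mem_stabilizer_iff.mp hn.1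
  have hny : γ₀ ^ p ^ n • y = y := MulAction.mem_stabilizer_iff.mp hn.2
  -- the norm condition at level `n + k`
  have hnorm : sSeq γ₀ b (p ^ (n + k)) = 0 := by
    rw [pow_add, mul_comm, sSeq_mul_eq_nsmul γ₀ b hnb, ← sSeq_nsmul, hbk, sSeq_smul_sub, hny, sub_self]
  exact κ.exists_cocycle_vanishing_apply_eq_of_sSeq_eq_zero hγ₀ hcont b hb hnorm

end Cocycle

end Summit.BirchSwinnertonDyer.BirchSwinnertonDyer.Theorems.InputsGreenbergLemma34

end
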